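import Summits.QuantumFields.YangMills.Theorems.FluctuationComparisonRegPrIntLSupTailFloorDepthOne
import HarnessLib

/-!
# `FluctuationComparisonRegPrIntLHaarFloorDepthOne` — THE HAAR FLOOR OF THE UV-SMALL HISTORY OVER AN INTERIOR DATUM, AT DEPTH ONE, UNCONDITIONALLY:
# `ofReal q · dU_{J+1}(D⁻¹B) ≤ dU_{J+1}(D⁻¹B ∩ histGood(θBal b₀) (J+1) J)` for every measurable `B` in the interior window `W_J(c·b₀)`
# (crux `UnitScaleTilt.FluctuationComparisonRegPrIntL`, stmt-QuantumFields-20520; companion of ✓`…SupTailFloorDepthOne` (the GIBBS floor `floor_depthOne`), of LEAD w3-20520 g18's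
# TUBE∘-SPLIT ✓`…SectionTubeSplit` (whose ⟨HAAR-TUBE₁⟩ letter is in FULL Haar currency `ofReal q′·dU(D⁻¹B) ≤ dU(D⁻¹B ∩ T_σ)`) and of px8 g14's `Sfine`-RELATIVE door ✓`…HaarTubeOneStep`
# (`ofReal q·dU(D⁻¹B ∩ Sfine) ≤ dU(D⁻¹B ∩ Sfine ∩ T_σ)`): this file is the bridge `dU(D⁻¹B ∩ Sfine) ≥ ofReal q″·dU(D⁻¹B)` at `Sfine = histGood`)

Cell `ym3-torus` (YM ladder rung R3 = continuum SU(2) Yang–Mills on T³ — a RUNG, NOT the Clay problem: not d = 4, not infinite volume, not a mass gap);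
width seat `ym3-torus-px20` (gen 11); helper `--supports stmt-QuantumFields-20520`.  THEOREMS ONLY (0 `def`, 0 `sorry`, default heartbeats).

WHAT.  At a FIXED run `K` the Gibbs measure and product Haar are comparable with explicit constants: `Z_K·Gibbs_K(A) ≤ dU_K(A)` (`e^{−βA} ≤ 1`) and
`dU_K(A) ≤ Z_K·e^{2β_K·#plaq}·Gibbs_K(A)` (`e^{−βA} ≥ e^{−2β·#plaq}`, ✓`HeightChiSqLOfFibreLawBound.boltzmann_ge`).  Hence the GIBBS floor of ✓`…SupTailFloorDepthOne.floor_depthOne`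
(`ofReal q·Gibbs_{J+1}(D⁻¹B) ≤ Gibbs_{J+1}(D⁻¹B ∩ histGood)`, `q = q(F, γ, J, c)`) transfers to a HAAR floor with `q″ = q·e^{−2β_{J+1}·#plaq_{J+1}}` — nothing `K`-uniform is needed or claimed
at depth one.
* §1 `gibbsK_le_inv_partitionFn_mul` (`Gibbs_K(A) ≤ Z⁻¹·dU(A)`), `fieldMeasure_le_exp_mul_partitionFn_mul_gibbsK` (`dU(A) ≤ ofReal(Z·e^{2β·#plaq})·Gibbs_K(A)`).
* §2 ★★`haarFloor_of_gibbsFloor` (one `(J,K)`: a Gibbs floor with `q` ⇒ a Haar floor with `q·e^{−2β_K·#plaq_K}`) · ★★★`haarFloor_histGood_depthOne` — for every `L, b₀, p₀ > 0`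
  there is `γ₁ > 0` (WREG's) such that for every family `F` (`F.L = L`), `0 < γ ≤ γ₁`, level `J`, fraction `0 < c < 1`: `∃ q > 0, ∀ B` measurable `⊆ W_J(c·b₀)`,
  `ofReal q·dU_{J+1}(D⁻¹B) ≤ dU_{J+1}(D⁻¹B ∩ histGood(θBal b₀) (J+1) J)`.
USE.  LEAD w3-20520 g18's ⟨HAAR-TUBE₁⟩ (full Haar currency) ⟸ px8 g14's `Sfine`-relative tube door at `Sfine = histGood(θBal b₀)(J+1) J` ∘ this Haar floor:
`dU(D⁻¹B ∩ T_σ) ≥ dU(D⁻¹B ∩ Sfine ∩ T_σ) ≥ ofReal q·dU(D⁻¹B ∩ Sfine) ≥ ofReal(q·q″)·dU(D⁻¹B)` (§3 ★★`haarTube_of_relative_and_floor`, measure arithmetic).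
HONEST SCOPE.  Measure bookkeeping over landed theorems; the `Sfine`-relative tube letter stays the HYPOTHESIS of §3; ⟨HAAR-TUBE₁⟩'s chart-level local charge, TUBE∘,
PERS₁∘, 20520, `YM3TorusSU2` NOT proved; the Yang–Mills mass gap is NOT proved.
HYP-SAT (cell RULING №42).  §1–§2 hypothesis-free on the literal T³ families (`γ` in WREG's range); §3's letter = px8's door output (supplied by w4-20520 g18's `hfib_of_pos` once the
pointwise local charge is typed).
References: [Balaban1985UV3] (2) p. 256, (7) p. 257, (38)–(40) p. 266; [Balaban1987RG1] (0.2) p. 252, (0.4) p. 253; [Balaban1985Averaging] (10) p. 19.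
-/

noncomputable section

set_option autoImplicit false

open MeasureTheory ProbabilityTheory Filter Topology Set
open scoped ENNReal NNReal BigOperators
open Literature.MathematicalPhysics.QuantumFieldTheory.Balaban1983to89
open Literature.MathematicalPhysics.QuantumFieldTheory.Balaban1983to89.T3ContinuumYM3Torus
open Literature.MathematicalPhysics.QuantumFieldTheory.Balaban1983to89.T3NestedUnitLaws
open Literature.MathematicalPhysics.QuantumFieldTheory.Balaban1983to89.T3UnitLawDensityEML
open Literature.MathematicalPhysics.QuantumFieldTheory.Balaban1983to89.T3UnitScaleTilt
open Literature.MathematicalPhysics.QuantumFieldTheory.Balaban1983to89.T3TiltDescent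
open Literature.MathematicalPhysics.QuantumFieldTheory.Balaban1983to89.Missing
open scoped Literature.MathematicalPhysics.QuantumFieldTheory.Balaban1983to89.T3OrbitAverage
open Summit.QuantumFields.YangMills.Theorems.FluctuationComparisonRegPrIntLSupTailFloorDepthOne (floor_depthOne)

namespace Summit.QuantumFields.YangMills.Theorems.FluctuationComparisonRegPrIntLHaarFloorDepthOne

/-! ## §1 Gibbs and Haar are comparable at a fixed run -/

section Compare

variable (F : T3Family) {γ : ℝ} (K : ℕ)

/-- `Gibbs_K(A) ≤ Z_K⁻¹·dU_K(A)` (`e^{−βA} ≤ 1`). [cite: Balaban1987RG1, (0.2) p.252] -/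
theorem gibbsK_le_inv_partitionFn_mul (hγ : 0 ≤ γ) (A : Set (GaugeField (F.P K) 0 (Matrix.specialUnitaryGroup (Fin 2) ℂ))) :
    gibbsK F ℰp γ K A ≤
      (ENNReal.ofReal (partitionFn (G := Matrix.specialUnitaryGroup (Fin 2) ℂ) (F.P K) ((F.scheme ℰp γ).β K)))⁻¹ *
        fieldMeasure (F.P K) 0 (Matrix.specialUnitaryGroup (Fin 2) ℂ) A := by
  have hβ : 0 ≤ (F.scheme ℰp γ).β K := F.scheme_β_nonneg ℰp hγ K
  have hwd : (fieldMeasure (F.P K) 0 (Matrix.specialUnitaryGroup (Fin 2) ℂ)).withDensity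
      (fun U => ENNReal.ofReal (boltzmann (F.P K) ((F.scheme ℰp γ).β K) U)) ≤ fieldMeasure (F.P K) 0 (Matrix.specialUnitaryGroup (Fin 2) ℂ) := by
    have h1 := withDensity_mono (μ := fieldMeasure (F.P K) 0 (Matrix.specialUnitaryGroup (Fin 2) ℂ))
      (f := fun U => ENNReal.ofReal (boltzmann (F.P K) ((F.scheme ℰp γ).β K) U)) (g := 1)
      (ae_of_all _ fun U => ENNReal.ofReal_le_one.mpr (boltzmann_le_one _ hβ U))
    rwa [withDensity_one] at h1
  rw [gibbsK_eq, T4GenFunBounds.gibbsMeasure, Measure.smul_apply, smul_eq_mul]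
  exact mul_le_mul' le_rfl (Measure.le_iff'.mp hwd A)

/-- `dU_K(A) ≤ ofReal(Z_K·e^{2β_K·#plaq_K})·Gibbs_K(A)` for measurable `A` (`e^{−βA} ≥ e^{−2β·#plaq}`, ✓`boltzmann_ge`). [cite: Balaban1987RG1, (0.2) p.252] -/
theorem fieldMeasure_le_exp_mul_partitionFn_mul_gibbsK (hγ : 0 ≤ γ) {A : Set (GaugeField (F.P K) 0 (Matrix.specialUnitaryGroup (Fin 2) ℂ))}
    (hA : MeasurableSet A) :
    fieldMeasure (F.P K) 0 (Matrix.specialUnitaryGroup (Fin 2) ℂ) A ≤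
      ENNReal.ofReal (partitionFn (G := Matrix.specialUnitaryGroup (Fin 2) ℂ) (F.P K) ((F.scheme ℰp γ).β K) *
          Real.exp ((F.scheme ℰp γ).β K * (2 * Fintype.card (Plaq (F.P K) 0)))) * gibbsK F ℰp γ K A := by
  set β := (F.scheme ℰp γ).β K with hβdef
  have hβ : 0 ≤ β := F.scheme_β_nonneg ℰp hγ K
  set Z := partitionFn (G := Matrix.specialUnitaryGroup (Fin 2) ℂ) (F.P K) β with hZdef
  have hZ : 0 < Z := partitionFn_pos' (F.P K) hβ
  set m : ℝ := Real.exp (-(β * (2 * Fintype.card (Plaq (F.P K) 0)))) with hm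
  have hm0 : 0 < m := Real.exp_pos _
  -- `ofReal m · dU(A) ≤ ∫⁻_A boltz = Z · Gibbs(A)`
  have h1 : ENNReal.ofReal m * fieldMeasure (F.P K) 0 (Matrix.specialUnitaryGroup (Fin 2) ℂ) A ≤
      ∫⁻ U in A, ENNReal.ofReal (boltzmann (F.P K) β U) ∂fieldMeasure (F.P K) 0 (Matrix.specialUnitaryGroup (Fin 2) ℂ) := by
    calc ENNReal.ofReal m * fieldMeasure (F.P K) 0 (Matrix.specialUnitaryGroup (Fin 2) ℂ) A
        = ∫⁻ _ in A, ENNReal.ofReal m ∂fieldMeasure (F.P K) 0 (Matrix.specialUnitaryGroup (Fin 2) ℂ) := (setLIntegral_const A _).symm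
      _ ≤ ∫⁻ U in A, ENNReal.ofReal (boltzmann (F.P K) β U) ∂fieldMeasure (F.P K) 0 (Matrix.specialUnitaryGroup (Fin 2) ℂ) :=
          lintegral_mono fun U => ENNReal.ofReal_le_ofReal (HeightChiSqLOfFibreLawBound.boltzmann_ge (F.P K) hβ U)
  have h2 : ∫⁻ U in A, ENNReal.ofReal (boltzmann (F.P K) β U) ∂fieldMeasure (F.P K) 0 (Matrix.specialUnitaryGroup (Fin 2) ℂ) =
      ENNReal.ofReal Z * gibbsK F ℰp γ K A := by
    rw [gibbsK_eq, T4GenFunBounds.gibbsMeasure, Measure.smul_apply, withDensity_apply _ hA, smul_eq_mul, ← mul_assoc,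
      ENNReal.mul_inv_cancel ((ENNReal.ofReal_pos.mpr hZ).ne') ENNReal.ofReal_ne_top, one_mul]
  -- divide by `ofReal m`
  have hm' : ENNReal.ofReal m ≠ 0 := (ENNReal.ofReal_pos.mpr hm0).ne'
  calc fieldMeasure (F.P K) 0 (Matrix.specialUnitaryGroup (Fin 2) ℂ) A
      = (ENNReal.ofReal m)⁻¹ * (ENNReal.ofReal m * fieldMeasure (F.P K) 0 (Matrix.specialUnitaryGroup (Fin 2) ℂ) A) := by
        rw [← mul_assoc, ENNReal.inv_mul_cancel hm' ENNReal.ofReal_ne_top, one_mul]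
    _ ≤ (ENNReal.ofReal m)⁻¹ * (ENNReal.ofReal Z * gibbsK F ℰp γ K A) := mul_le_mul' le_rfl (h1.trans (le_of_eq h2))
    _ = ENNReal.ofReal (Z * Real.exp (β * (2 * Fintype.card (Plaq (F.P K) 0)))) * gibbsK F ℰp γ K A := by
        rw [← mul_assoc, ← ENNReal.ofReal_inv_of_pos hm0, ← ENNReal.ofReal_mul (inv_nonneg.mpr hm0.le), hm, Real.exp_neg, inv_inv, mul_comm (Real.exp _) Z]

end Compare

/-! ## §2 The Haar floor of the UV-small history over an interior datum, at depth one -/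

section Floor

variable (F : T3Family) {γ : ℝ} (b₀ p₀ c : ℝ) {J K : ℕ} (hJK : J ≤ K)

/-- ★★ **A GIBBS FLOOR IS A HAAR FLOOR AT A FIXED RUN**: if `ofReal q·Gibbs_K(D⁻¹B) ≤ Gibbs_K(D⁻¹B ∩ G)` for the measurable `B`'s of some family, then
`ofReal(q·e^{−2β_K·#plaq_K})·dU_K(D⁻¹B) ≤ dU_K(D⁻¹B ∩ G)` for the same `B`'s (any `G`; §1). [cite: Balaban1987RG1, (0.2) p.252; Balaban1985UV3, (2) p.256] -/
theorem haarFloor_of_gibbsFloor (hγ : 0 ≤ γ) (G : Set (GaugeField (F.P K) 0 (Matrix.specialUnitaryGroup (Fin 2) ℂ))) {q : ℝ} (hq : 0 < q)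
    {B : Set (GaugeField (F.P J) 0 (Matrix.specialUnitaryGroup (Fin 2) ℂ))} (hB : MeasurableSet B)
    (h : ENNReal.ofReal q * gibbsK F ℰp γ K (descendTo F ℰp J K hJK ⁻¹' B) ≤ gibbsK F ℰp γ K (descendTo F ℰp J K hJK ⁻¹' B ∩ G)) :
    ENNReal.ofReal (q * Real.exp (-((F.scheme ℰp γ).β K * (2 * Fintype.card (Plaq (F.P K) 0))))) *
        fieldMeasure (F.P K) 0 (Matrix.specialUnitaryGroup (Fin 2) ℂ) (descendTo F ℰp J K hJK ⁻¹' B) ≤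
      fieldMeasure (F.P K) 0 (Matrix.specialUnitaryGroup (Fin 2) ℂ) (descendTo F ℰp J K hJK ⁻¹' B ∩ G) := by
  set β := (F.scheme ℰp γ).β K with hβdef
  have hβ : 0 ≤ β := F.scheme_β_nonneg ℰp hγ K
  set Z := partitionFn (G := Matrix.specialUnitaryGroup (Fin 2) ℂ) (F.P K) β with hZdef
  have hZ : 0 < Z := partitionFn_pos' (F.P K) hβ
  set N : ℝ := 2 * Fintype.card (Plaq (F.P K) 0) with hN
  have hD : Measurable (descendTo F ℰp J K hJK) := measurable_descendTo F ℰp measurableE_ℰp hJK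
  have hpre : MeasurableSet (descendTo F ℰp J K hJK ⁻¹' B) := hD hB
  -- `dU(D⁻¹B) ≤ ofReal(Z e^{βN}) · Gibbs(D⁻¹B)` and `Gibbs(D⁻¹B ∩ G) ≤ Z⁻¹ · dU(D⁻¹B ∩ G)`
  have hup := fieldMeasure_le_exp_mul_partitionFn_mul_gibbsK F K hγ hpre
  have hlow := gibbsK_le_inv_partitionFn_mul F K hγ (descendTo F ℰp J K hJK ⁻¹' B ∩ G)
  have hZinv : (ENNReal.ofReal Z)⁻¹ = ENNReal.ofReal Z⁻¹ := (ENNReal.ofReal_inv_of_pos hZ).symm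
  -- constants: `ofReal(q e^{−βN}) · ofReal(Z e^{βN}) = ofReal q · ofReal Z`
  have hconst : ENNReal.ofReal (q * Real.exp (-(β * N))) * ENNReal.ofReal (Z * Real.exp (β * N)) = ENNReal.ofReal Z * ENNReal.ofReal q := by
    rw [← ENNReal.ofReal_mul (by positivity), ← ENNReal.ofReal_mul hZ.le]
    congr 1
    rw [Real.exp_neg]
    field_simp
  calc ENNReal.ofReal (q * Real.exp (-(β * N))) * fieldMeasure (F.P K) 0 (Matrix.specialUnitaryGroup (Fin 2) ℂ) (descendTo F ℰp J K hJK ⁻¹' B)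
      ≤ ENNReal.ofReal (q * Real.exp (-(β * N))) * (ENNReal.ofReal (Z * Real.exp (β * N)) * gibbsK F ℰp γ K (descendTo F ℰp J K hJK ⁻¹' B)) :=
        mul_le_mul' le_rfl hup
    _ = ENNReal.ofReal Z * (ENNReal.ofReal q * gibbsK F ℰp γ K (descendTo F ℰp J K hJK ⁻¹' B)) := by rw [← mul_assoc, hconst, mul_assoc]
    _ ≤ ENNReal.ofReal Z * gibbsK F ℰp γ K (descendTo F ℰp J K hJK ⁻¹' B ∩ G) := mul_le_mul' le_rfl h
    _ ≤ ENNReal.ofReal Z * ((ENNReal.ofReal Z)⁻¹ * fieldMeasure (F.P K) 0 (Matrix.specialUnitaryGroup (Fin 2) ℂ) (descendTo F ℰp J K hJK ⁻¹' B ∩ G)) :=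
        mul_le_mul' le_rfl hlow
    _ = fieldMeasure (F.P K) 0 (Matrix.specialUnitaryGroup (Fin 2) ℂ) (descendTo F ℰp J K hJK ⁻¹' B ∩ G) := by
        rw [← mul_assoc, ENNReal.mul_inv_cancel ((ENNReal.ofReal_pos.mpr hZ).ne') ENNReal.ofReal_ne_top, one_mul]

/-- ★★★ **THE HAAR FLOOR OF THE UV-SMALL HISTORY OVER AN INTERIOR DATUM, AT DEPTH ONE, UNCONDITIONALLY**: for every block size `L` and profile `b₀, p₀ > 0` there is `γ₁ > 0`
(WREG's) such that for every family `F` (`F.L = L`), `0 < γ ≤ γ₁`, level `J` and fraction `0 < c < 1` there is `q > 0` with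
`ofReal q·dU_{J+1}(D⁻¹B) ≤ dU_{J+1}(D⁻¹B ∩ histGood(θBal b₀) (J+1) J)` for every measurable `B ⊆ W_J(c·b₀)` — ✓`floor_depthOne` (the Gibbs floor, from WREG + the 26133 domination
letters) transferred to Haar by `haarFloor_of_gibbsFloor` (`q := q_Gibbs·e^{−2β_{J+1}·#plaq_{J+1}}`; `q` depends on `(F, γ, J, c)`). [cite: Balaban1985UV3, (2) p.256, (7) p.257 and (38)-(40) p.266] -/
theorem haarFloor_histGood_depthOne :
    ∀ (L : ℕ) (b₀ p₀ : ℝ), 0 < b₀ → 0 < p₀ → ∃ γ₁ : ℝ, 0 < γ₁ ∧ ∀ (F : T3Family) (γ : ℝ), F.L = L → 0 < γ → γ ≤ γ₁ →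
      ∀ (J : ℕ) (c : ℝ), 0 < c → c < 1 →
        ∃ q : ℝ, 0 < q ∧ ∀ B : Set (GaugeField (F.P J) 0 (Matrix.specialUnitaryGroup (Fin 2) ℂ)), MeasurableSet B →
          B ⊆ {U | PlaqSmall (θBal F.L γ (c * b₀) p₀ J) U} →
          ENNReal.ofReal q * fieldMeasure (F.P (J + 1)) 0 (Matrix.specialUnitaryGroup (Fin 2) ℂ) (descendTo F ℰp J (J + 1) (Nat.le_succ J) ⁻¹' B) ≤
            fieldMeasure (F.P (J + 1)) 0 (Matrix.specialUnitaryGroup (Fin 2) ℂ)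
              (descendTo F ℰp J (J + 1) (Nat.le_succ J) ⁻¹' B ∩ histGood F ℰp (θBal F.L γ b₀ p₀) (J + 1) J) := by
  intro L b₀ p₀ hb₀ hp₀
  obtain ⟨γ₁, hγ₁, hfl⟩ := floor_depthOne L b₀ p₀ hb₀ hp₀
  refine ⟨γ₁, hγ₁, fun F γ hFL hγ hγle J c hc0 hc1 => ?_⟩
  obtain ⟨q, hq, hqB⟩ := hfl F γ hFL hγ hγle J c hc0 hc1
  refine ⟨q * Real.exp (-((F.scheme ℰp γ).β (J + 1) * (2 * Fintype.card (Plaq (F.P (J + 1)) 0)))), by positivity, fun B hB hBW => ?_⟩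
  exact haarFloor_of_gibbsFloor F (Nat.le_succ J) hγ.le (histGood F ℰp (θBal F.L γ b₀ p₀) (J + 1) J) hq hB (hqB B hB hBW)

end Floor

/-! ## §3 From the `Sfine`-relative tube charge to the full Haar currency of ⟨HAAR-TUBE₁⟩ -/

section Bridge

variable {X : Type*} [MeasurableSpace X]

/-- ★★ **RELATIVE TUBE CHARGE + FLOOR ⇒ FULL TUBE CHARGE** (measure arithmetic): `ofReal q₁·μ(A ∩ S) ≤ μ(A ∩ S ∩ T)` and `ofReal q₂·μ(A) ≤ μ(A ∩ S)` with `q₁, q₂ ≥ 0`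
give `ofReal(q₁·q₂)·μ(A) ≤ μ(A ∩ T)`.  USE: `μ = dU_{J+1}`, `A = D⁻¹B`, `S = histGood`, `T = T_σ` — px8 g14's `Sfine`-relative door ✓`…HaarTubeOneStep` ∘ §2 ⇒ LEAD w3 g18's
⟨HAAR-TUBE₁⟩ letter of ✓`…SectionTubeSplit` in full Haar currency. [cite: Balaban1985Averaging, Prop. 1 p.22; Balaban1987RG1, (0.4) p.253] -/
theorem haarTube_of_relative_and_floor (μ : Measure X) {A S T : Set X} {q₁ q₂ : ℝ} (hq₁ : 0 ≤ q₁)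
    (hrel : ENNReal.ofReal q₁ * μ (A ∩ S) ≤ μ (A ∩ S ∩ T)) (hfloor : ENNReal.ofReal q₂ * μ A ≤ μ (A ∩ S)) :
    ENNReal.ofReal (q₁ * q₂) * μ A ≤ μ (A ∩ T) := by
  calc ENNReal.ofReal (q₁ * q₂) * μ A = ENNReal.ofReal q₁ * (ENNReal.ofReal q₂ * μ A) := by rw [ENNReal.ofReal_mul hq₁, mul_assoc]
    _ ≤ ENNReal.ofReal q₁ * μ (A ∩ S) := mul_le_mul' le_rfl hfloor
    _ ≤ μ (A ∩ S ∩ T) := hrel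
    _ ≤ μ (A ∩ T) := measure_mono fun x hx => ⟨hx.1.1, hx.2⟩

end Bridge

end Summit.QuantumFields.YangMills.Theorems.FluctuationComparisonRegPrIntLHaarFloorDepthOne

end
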